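import Literature.MathematicalPhysics.QuantumFieldTheory.Balaban1983to89.T4HistoryLipschitzSegment

/-!
# NE9WeightedClauseEnd — the P2-road END faces on a cube chart made CURRENCY-AGNOSTIC: the KP clause on the box majorant, the
extracted decay and the pin budget displayed as THREE NAMED BINDERS with arbitrary weights (cell `pub-balaban`, T4-DAG §2 node U3 /
§6 NE9; repair item NE9-F8 «d-currency dischargers» PART 2, STAGE A; unit `b2b-balaban-t4-ne9-formalise-leaf-10`, gen 2)

HONEST FRAMING (T4-DAG PAGE 1).  Rung (B)+1 on a FIXED finite torus — NOT infinite volume, NOT a mass gap, NOT the Clay problem.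
NE9 is a cell NEW ESTIMATE, NOT PRINTED, and is NOT discharged here: this module is COMPOSITION ONLY (`[folklore]` bookkeeping over
the tree's `T4HistoryLipschitzSegment` / `…CubeGeometry`), every analytic input stays a DISPLAYED binder, nothing of [I]–[III] is
asserted, `FlowStep.BetaPertH`, (B), (B^μ) do not occur.  HONEST DEPENDENCY (verbatim): continuum YM on T⁴ ⇐ BetaPertH ∧ nine spine
estimates (0/9 proved); BetaPertH ⇐ (D1) ∧ (D4) ∧ CAP+tail; G-an2-4 gates asym, D1 and NE2/3/4.

WHY.  The tree's END faces of the P2 road on a cube chart — `T4HistoryLipschitzSegment.cubeChart_ne9_and_fadingMemory_of_box` /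
`…_of_boxMajorant` / `…_of_sizeInduction`, and through them E2 `T4HistoryLipschitzLinearSize.torus_ne9_and_fadingMemory_of_linSizeDecay`
and E5 `NE9PrintedMajorantDecay.torus_ne9_and_fadingMemory_of_printedDecay` — HARD-WIRE the CUBE-COUNT dischargers of the geometry
and entropy binders: KP weights `sizeWeight a₁` / `sizeWeight d₁` per cube, extracted decay `δ X = d₁·#cubes X`, pin budget `a₁`,
and the Kotecký–Preiss clause from `Supported.kpClause_of_decay` with the scalars `y·e^{a₁+d₁}·e^{Dθ} ≤ θ`, `κ ≤ d₁`.  Journal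
finding F-ne9leaf01-1 (cell records) prices this: through these faces the NE9 rate is DIVIDED (`κ ≤ d₁ < a′/2^ν` when the box
majorant decays like `e^{−a′·d(Z)}` in Bałaban's linear size, [II] Lemma 3 (2.38) p. 20 TYPE) and the fading product carries
`e^{a+a′}`, whereas print extracts decay in d-currency ((2.27) p. 18 «Σ_{Y∈𝐃}(d_k(Y) + 5) ≥ d_k(Y₀) + 5») and converts only the
entropy count to cubes ((2.29)–(2.30) p. 18), losing additively.  The repair (NE9-F8) supplies the three binders in d-currency
(PART 1, another seat); THIS module (PART 2, stage A) makes the END faces ACCEPT any currency: the clause, `DecayExtract` and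
`PinBudget` are displayed with ARBITRARY nonnegative weights `a d : Finset α → ℝ`, extracted decay `δ : C.Dom → ℝ` and budget `B`,
exactly as the two-history bridge faces END-B/END-S (`Support/NE9LastCouplingBridge`, `…BridgeSizeInduction`) already do one level
up (they display `TwoPointKP` itself).

WHAT IS PROVED (kernel, composition BY NAME; 0 `def`, 0 sorry).
§1 `twoPointKP_of_boxMajorantClause` — `TwoPointKP Γ.geom W act (boxSet β) (segMajorant …) lip a d` for arbitrary weights from the
   regularity data, ONE integrability, the (L′) scale bound `coeffSum ≤ lip k·#γ` and a DISPLAYED KP clause ON THE BOX MAJORANT with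
   the polynomial factor `2(1 + #γ′)` explicit (∘ `twoPointKP_of_avgEvalExpLinear_box`, `segMajorant_le_one_add_mul`).
§2 `ne9_and_fadingMemory_of_weightedClause` — occupation form (tables in the box `β k`): NE9 ∧ FadingMemory with moduli
   `ℓ·∏(ω + 4·lipbar·B·τ̄)` from the clause, `hdec : Γ.geom.DecayExtract δ d`, `hpin : Γ.geom.PinBudget a δ (fun _ => B) κ`
   (∘ `ne9_and_fadingMemory_of_twoPointKP_perStep`).
§3 `termSize_and_ne9_of_weightedClause` — size-induction form: the occupation DERIVED from (B0), (X), (N) `p₀ j + B ≤ N (j+1)`, (R′)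
   (∘ `termSize_of_recursion`); conclusion `TermSize E W κ N ∧ NE9 … ∧ FadingMemory …`.
§4 CONSISTENCY — the cube-count currency INHABITS the three binders: `boxMajorantClause_of_cubeDecay` (the clause with
   `a = sizeWeight a₁`, `d = sizeWeight d₁` from the tree's (A″) decay `ε k·y^{#γ′}` and scalars, ∘ `Supported.kpClause_of_decay`), and
   `cubeChart_ne9_and_fadingMemory_of_sizeInduction'` — the tree's `cubeChart_ne9_and_fadingMemory_of_sizeInduction` RE-DERIVED,
   hypothesis for hypothesis, from §3 (so the generic trunk provably subsumes the existing faces; PART 1's d-currency producers are to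
   inhabit the same three binders, giving the E5′ face of stage B).
DISGUISE TEST.  The three binders are ONE-history statements about configuration-free majorants and lattice geometry at the occurring
coupling; no second history, no difference of couplings — not NE9 in disguise (unchanged from the faces they generalise).

References (TYPES only): [Balaban1988RG2Cluster] T. Bałaban, CMP 116 (1988) (1.36) p. 9, (2.11)–(2.15) pp. 14–15, (2.18)–(2.20)
p. 16, (2.23)–(2.27) pp. 17–18, (2.29)–(2.30) p. 18, Lemma 3 (2.38) p. 20, (2.40)–(2.41) p. 21 and p. 21 text; [Balaban1987RG1] CMP 109
(1987) (0.23) p. 256, p. 257, (1.18) p. 263; [KoteckyPreiss1986] CMP 103 (1986) (1)–(3).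
-/

noncomputable section

namespace Summit.QuantumFields.BalabanUV.T4Continuum.NE9WeightedClauseEnd

open scoped BigOperators
open Metric Set MeasureTheory BoundedContinuousFunction
open Literature.Probability.LatticeModels
open Literature.MathematicalPhysics.QuantumFieldTheory
open Literature.MathematicalPhysics.QuantumFieldTheory.Balaban1983to89
open Literature.MathematicalPhysics.QuantumFieldTheory.Balaban1983to89.T4OutputRate
open Literature.MathematicalPhysics.QuantumFieldTheory.Balaban1983to89.T4ActivityLipschitz
open Literature.MathematicalPhysics.QuantumFieldTheory.Balaban1983to89.T4HistoryLipschitzRecursion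
open Literature.MathematicalPhysics.QuantumFieldTheory.Balaban1983to89.T4HistoryLipschitzOuter
open Literature.MathematicalPhysics.QuantumFieldTheory.Balaban1983to89.T4HistoryLipschitzActivity
open Literature.MathematicalPhysics.QuantumFieldTheory.Balaban1983to89.T4HistoryLipschitzEntropy
open Literature.MathematicalPhysics.QuantumFieldTheory.Balaban1983to89.T4HistoryLipschitzCubeGeometry
open Literature.MathematicalPhysics.QuantumFieldTheory.Balaban1983to89.T4HistoryLipschitzActivity (ClusterGeom)
open Literature.MathematicalPhysics.QuantumFieldTheory.Balaban1983to89.T4HistoryLipschitzSegment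

variable {C : Carriers} {α : Type} [DecidableEq α] {adj : α → α → Prop} [DecidableRel adj] [Std.Symm adj] {D : ℕ}
variable {Bg : Type} {Sp : Type*} [TopologicalSpace Sp] [MeasurableSpace Sp] [OpensMeasurableSpace Sp] {F : Type*}
  [Fintype F] {Ω : Type*} [MeasurableSpace Ω]

/-! ## §1 TWO-POINT KP on the box from a KP clause ON THE BOX MAJORANT with arbitrary weights -/

/-- **TWO-POINT KP FROM A WEIGHT-GENERIC CLAUSE ON THE BOX MAJORANT (kernel).**  On a cube chart, the averaged exp-evaluation
activities satisfy `TwoPointKP` on the boxes `β k` with the segment majorant, the scales `lip k > 0` and ARBITRARY nonnegative weights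
`a d` on the cube families, GIVEN the regularity data, ONE integrability (TYPE (2.23)–(2.25)), the (L′) scale bound
`Σ_Y ‖c_ω(Y)‖ ≤ lip k·#γ` (TYPE: radii (2.18) × sizes (1.36) summed by (2.19) p. 16) and the DISPLAYED Kotecký–Preiss clause for the box
majorant `∫‖pre‖e^{boxExponent}dμ` (TYPE (2.26) p. 17 → Lemma 3 (2.38) p. 20, ONE table; class-uniformity displayed) carrying the
polynomial factor `2(1 + #γ′)` of `segMajorant_le_one_add_mul`.  Which currency discharges the clause (cube count:
§4; linear size: NE9-F8 part 1) is left to the instantiator. [cite: Balaban1988RG2Cluster, (2.18)-(2.20) p.16, (2.23)-(2.26) p.17, Lemma 3 (2.38) p.20; KoteckyPreiss1986, (1)-(3)] -/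
theorem twoPointKP_of_boxMajorantClause (Γ : CubeChart C α adj D) {W : Set (ℕ → ℝ)}
    {μ : ℕ → ℝ → Bg → Finset α → Measure Ω} {pre : ℕ → ℝ → Bg → Finset α → Ω → ℂ}
    {c : ℕ → ℝ → Bg → Finset α → Ω → F → ℂ} {pt : ℕ → ℝ → Bg → Finset α → Ω → F → Sp} {β : ℕ → Sp → ℝ}
    {lip : ℕ → ℝ} {a d : Finset α → ℝ} (ha : ∀ γ, 0 ≤ a γ) (hd : ∀ γ, 0 ≤ d γ) (hlip : ∀ k, 0 < lip k)
    (hpre : ∀ k s U γ, AEStronglyMeasurable (pre k s U γ) (μ k s U γ))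
    (hc : ∀ k s U γ Y, AEStronglyMeasurable (fun ω => c k s U γ ω Y) (μ k s U γ))
    (hpt : ∀ k s U γ Y, Measurable fun ω => pt k s U γ ω Y)
    (hint₀ : ∀ k s U γ, Integrable (fun ω => ‖pre k s U γ ω‖ * Real.exp (boxExponent c pt β k s U γ ω)) (μ k s U γ))
    (hL : ∀ k s U (γ : Finset α) ω, coeffSum c k s U γ ω ≤ lip k * (γ.card : ℝ))
    (hkpBox : ∀ g ∈ W, ∀ (k : ℕ) (U : Bg) (X : C.Dom), C.scale X = k + 1 → ∀ γ ∈ Γ.geom.vol X,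
      ∑ γ' ∈ Γ.geom.vol X with Γ.geom.inc γ' γ,
        2 * ((1 + ((γ' : Finset α).card : ℝ)) *
          ∫ ω, ‖pre k (g k) U γ' ω‖ * Real.exp (boxExponent c pt β k (g k) U γ' ω) ∂(μ k (g k) U γ')) *
          Real.exp (a γ' + d γ') ≤ a γ) :
    TwoPointKP Γ.geom W (Γ.geom.avgExpLinearAct μ pre fun k s U γ ω => evalFunctional (c k s U γ ω) (pt k s U γ ω))
      (fun k => boxSet (β k)) (segMajorant μ pre (coeffSum c) (boxExponent c pt β) lip) lip a d := by
  have hint₁ : ∀ k s U γ, Integrable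
      (fun ω => ‖pre k s U γ ω‖ * coeffSum c k s U γ ω * Real.exp (boxExponent c pt β k s U γ ω)) (μ k s U γ) :=
    fun k s U γ => integrable_weighted_of_le (aestronglyMeasurable_coeffSum hc k s U γ) (coeffSum_nonneg c k s U γ)
      (hL k s U γ) (hint₀ k s U γ)
  refine twoPointKP_of_avgEvalExpLinear_box Γ.geom ha hd hlip hpre hc hpt hint₀ hint₁ fun g hg k U X hX γ hγ => ?_
  refine le_trans (Finset.sum_le_sum fun γ' _ => ?_) (hkpBox g hg k U X hX γ hγ)
  have hseg : segMajorant μ pre (coeffSum c) (boxExponent c pt β) lip k (g k) U γ' ≤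
      (1 + ((γ' : Finset α).card : ℝ)) *
        ∫ ω, ‖pre k (g k) U γ' ω‖ * Real.exp (boxExponent c pt β k (g k) U γ' ω) ∂(μ k (g k) U γ') :=
    segMajorant_le_one_add_mul (hlip k) (coeffSum_nonneg c k (g k) U γ') (hL k (g k) U γ') (hint₀ k (g k) U γ')
  exact mul_le_mul_of_nonneg_right (mul_le_mul_of_nonneg_left hseg (by norm_num)) (Real.exp_nonneg _)

/-! ## §2 END, occupation form: NE9 ∧ FadingMemory from the three currency-agnostic binders -/

/-- **NE9 ∧ FADING MEMORY ON A CUBE CHART FROM THE WEIGHT-GENERIC CLAUSE, THE EXTRACTED DECAY AND THE PIN BUDGET (kernel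
end-to-end, occupation form).**  `T4HistoryLipschitzSegment.cubeChart_ne9_and_fadingMemory_of_boxMajorant` with its CUBE-COUNT
dischargers UN-WIRED: in place of `(A″) ε k·y^{#γ′}` + `hθ : 2y·e^{a₁+d₁}·e^{Dθ} ≤ θ` + `hεθ` + `hκd : κ ≤ d₁` (and the chart's built-in
`decayExtract`/`pinBudget`), THREE DISPLAYED binders with arbitrary weights `a d : Finset α → ℝ`, extracted decay `δ` and budget
`B`: the KP clause on the box majorant (§1), `hdec : Γ.geom.DecayExtract δ d` (TYPE (2.27) p. 18), `hpin : Γ.geom.PinBudget a δ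
(fun _ => B) κ` (TYPE (2.40)–(2.41) p. 21).  All other binders — recursion side `ScaleZeroFree` … `LastCouplingLipschitz` (NE9-LAST,
wall (L)), read-out `hρ`, factorisation `hΨ`, occupation in the box (TYPE (1.36)), regularity, (L′) — VERBATIM those of the tree
face; moduli `ℓ·∏(ω + 4·lipbar·B·τ̄)`, fading iff `ω + 4·lipbar·B·τ̄ < 1` (`fade_iff`).  Composition: §1 ∘
`ne9_and_fadingMemory_of_twoPointKP_perStep`.  Nothing of [I]–[III] asserted; rung (B)+1 bookkeeping. [cite: Balaban1988RG2Cluster, (1.36) p.9, (2.15) p.15, (2.18)-(2.20) p.16, (2.23)-(2.27) pp.17-18, Lemma 3 (2.38) p.20, (2.40)-(2.41) p.21; KoteckyPreiss1986, (1)-(3)] -/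
theorem ne9_and_fadingMemory_of_weightedClause (Γ : CubeChart C α adj D) {ι : Type} {E : Functional C Bg}
    {W : Set (ℕ → ℝ)} {Adm : Set (Bg → C.Dom → ℝ)} {T : ℕ → (ℕ → ℝ) → (Bg → C.Dom → ℝ) → ι → ℝ}
    {Ψ : ℕ → ℝ → (ι → ℝ) → Bg → C.Dom → ℝ}
    {μ : ℕ → ℝ → Bg → Finset α → Measure Ω} {pre : ℕ → ℝ → Bg → Finset α → Ω → ℂ}
    {c : ℕ → ℝ → Bg → Finset α → Ω → F → ℂ} {pt : ℕ → ℝ → Bg → Finset α → Ω → F → Sp} {β : ℕ → Sp → ℝ}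
    {lip : ℕ → ℝ} {a d : Finset α → ℝ} {δ : C.Dom → ℝ} {B κ lipbar ℓ τbar ω : ℝ} {wt : ℕ → ι → ℝ} {τ : ℕ → ℕ → ℝ}
    {lam : ℕ → ℝ} (ρ : ℕ → (ι → ℝ) → (Sp →ᵇ ℂ))
    -- recursion side (displayed, named binders of the P2 leaves)
    (h0 : ScaleZeroFree E W) (hAdm : AdmissibleTerms E W Adm) (hres : AdmRestrict Adm)
    (hadd : ChannelAdditive Adm T) (hsum : ChannelStepSum Adm T) (hstep : ChannelSizeAtStepNN Adm T κ wt τ)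
    (hfac : Factorises E W T Ψ) (hlast : LastCouplingLipschitz E W T Ψ κ lam)
    (hρ : ∀ (k : ℕ) (P P' : ι → ℝ) (M : ℝ), (∀ y, |P y - P' y| ≤ wt k y * M) → ‖ρ k P - ρ k P'‖ ≤ M)
    (hΨ : ∀ (k : ℕ) (s : ℝ) (P P' : ι → ℝ) (U : Bg) (X : C.Dom),
      Ψ k s P U X - Ψ k s P' U X =
        (Γ.geom.newTerm (Γ.geom.avgExpLinearAct μ pre fun k s U γ ω => evalFunctional (c k s U γ ω) (pt k s U γ ω))
            k s U X (ρ k P) -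
          Γ.geom.newTerm (Γ.geom.avgExpLinearAct μ pre fun k s U γ ω => evalFunctional (c k s U γ ω) (pt k s U γ ω))
            k s U X (ρ k P')).re)
    -- occupation: occurring tables lie in the box (TYPE (1.36)); no radius
    (hocc : ∀ g ∈ W, ∀ g' ∈ W, ∀ (k : ℕ) (x : Sp), ‖ρ k (T k g' (E g)) x‖ ≤ β k x)
    -- activity side: regularity data, scales, ONE integrability (TYPE (2.23)-(2.25)), (L′) scale bound
    (hpre : ∀ k s U γ, AEStronglyMeasurable (pre k s U γ) (μ k s U γ))
    (hc : ∀ k s U γ Y, AEStronglyMeasurable (fun ω => c k s U γ ω Y) (μ k s U γ))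
    (hpt : ∀ k s U γ Y, Measurable fun ω => pt k s U γ ω Y) (hlip : ∀ k, 0 < lip k) (hlipb : ∀ k, lip k ≤ lipbar)
    (hint₀ : ∀ k s U γ, Integrable (fun ω => ‖pre k s U γ ω‖ * Real.exp (boxExponent c pt β k s U γ ω)) (μ k s U γ))
    (hL : ∀ k s U (γ : Finset α) ω, coeffSum c k s U γ ω ≤ lip k * (γ.card : ℝ))
    -- THE THREE CURRENCY-AGNOSTIC BINDERS: KP clause on the box majorant, extracted decay, pin budget
    (ha : ∀ γ, 0 ≤ a γ) (hd : ∀ γ, 0 ≤ d γ)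
    (hkpBox : ∀ g ∈ W, ∀ (k : ℕ) (U : Bg) (X : C.Dom), C.scale X = k + 1 → ∀ γ ∈ Γ.geom.vol X,
      ∑ γ' ∈ Γ.geom.vol X with Γ.geom.inc γ' γ,
        2 * ((1 + ((γ' : Finset α).card : ℝ)) *
          ∫ ω, ‖pre k (g k) U γ' ω‖ * Real.exp (boxExponent c pt β k (g k) U γ' ω) ∂(μ k (g k) U γ')) *
          Real.exp (a γ' + d γ') ≤ a γ)
    (hdec : Γ.geom.DecayExtract δ d) (hpin : Γ.geom.PinBudget a δ (fun _ => B) κ)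
    -- envelope data
    (hB : 0 ≤ B) (hℓ : 0 ≤ ℓ) (hτbar : 0 ≤ τbar) (hω : 0 ≤ ω) (hpos : 0 < ω + 4 * lipbar * B * τbar)
    (hlam : ∀ k, lam k ≤ ℓ) (hτ : ∀ k j, j ≤ k → 0 ≤ τ k j ∧ τ k j ≤ τbar * ω ^ (k - j)) :
    NE9 E W κ (prodModuli ℓ fun _ => ω + 4 * lipbar * B * τbar) ∧
      FadingMemory (ℓ / (ω + 4 * lipbar * B * τbar)) (ω + 4 * lipbar * B * τbar)
        (prodModuli ℓ fun _ => ω + 4 * lipbar * B * τbar) := by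
  have hKP := twoPointKP_of_boxMajorantClause Γ (W := W) (μ := μ) (pre := pre) (c := c) (pt := pt) (β := β) ha hd hlip
    hpre hc hpt hint₀ hL hkpBox
  exact ne9_and_fadingMemory_of_twoPointKP_perStep Γ.geom ρ h0 hAdm hres hadd hsum hstep hfac hlast hKP hdec hpin hρ hΨ
    (fun g hg g' hg' k => fun x => hocc g hg g' hg' k x) hℓ hB hlipb hτbar hω hpos hlam hτ

/-! ## §3 END, size-induction form: the (I.1.18)-type size bound and the occupation DERIVED, then NE9 ∧ FadingMemory -/

/-- **THE SIZE BOUND, NE9 ∧ FADING MEMORY ON A CUBE CHART FROM THE WEIGHT-GENERIC CLAUSE (kernel end-to-end, size-induction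
form).**  `T4HistoryLipschitzSegment.cubeChart_ne9_and_fadingMemory_of_sizeInduction` (and `cubeChart_termSize_and_boxOcc`) with the
cube-count dischargers UN-WIRED as in §2: the occupation hypothesis is REPLACED by the size-induction data (B0) base size at scale 0
(TYPE [I] (0.23) p. 256), (X) the table-independent part `≤ e^{−κd}·p₀ k` window-uniformly, (N) a nonnegative profile with
`p₀ j + B ≤ N (j+1)` — `B` = THE PIN BUDGET of `hpin` (TYPE [II] p. 21 «O(1)C₃ε₁ ≦ ½E₀» + the absolute `½E₀`), (R′) the read-out of
the weighted output box of radius `sizeRadius τ N k` into the box `β k` (TYPE (2.19)–(2.20) p. 16); the three currency-agnostic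
binders of §2 displayed.  Conclusion: `TermSize E W κ N` for every history of the window AND the END of §2.  Composition: §1 ∘
`termSize_of_recursion` (∘ `channelSizeNN_of_perStepNN`) ∘ `ne9_and_fadingMemory_of_twoPointKP_perStep`.  Nothing of [I]–[III]
asserted; rung (B)+1 bookkeeping. [cite: Balaban1988RG2Cluster, (1.36) p.9, (2.19)-(2.20) p.16, (2.26)-(2.27) pp.17-18, (2.41) p.21 and p.21 text; Balaban1987RG1, (0.23) p.256, (1.18) p.263; KoteckyPreiss1986, (1)-(3)] -/
theorem termSize_and_ne9_of_weightedClause (Γ : CubeChart C α adj D) {ι : Type} {E : Functional C Bg}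
    {W : Set (ℕ → ℝ)} {Adm : Set (Bg → C.Dom → ℝ)} {T : ℕ → (ℕ → ℝ) → (Bg → C.Dom → ℝ) → ι → ℝ}
    {Ψ : ℕ → ℝ → (ι → ℝ) → Bg → C.Dom → ℝ}
    {μ : ℕ → ℝ → Bg → Finset α → Measure Ω} {pre : ℕ → ℝ → Bg → Finset α → Ω → ℂ}
    {c : ℕ → ℝ → Bg → Finset α → Ω → F → ℂ} {pt : ℕ → ℝ → Bg → Finset α → Ω → F → Sp} {β : ℕ → Sp → ℝ}
    {lip : ℕ → ℝ} {a d : Finset α → ℝ} {δ : C.Dom → ℝ} {B κ lipbar ℓ τbar ω : ℝ} {wt : ℕ → ι → ℝ} {τ : ℕ → ℕ → ℝ}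
    {lam p₀ N : ℕ → ℝ} (ρ : ℕ → (ι → ℝ) → (Sp →ᵇ ℂ))
    -- recursion side (displayed, named binders of the P2 leaves)
    (h0 : ScaleZeroFree E W) (hAdm : AdmissibleTerms E W Adm) (hres : AdmRestrict Adm)
    (hadd : ChannelAdditive Adm T) (hsum : ChannelStepSum Adm T) (hstep : ChannelSizeAtStepNN Adm T κ wt τ)
    (hfac : Factorises E W T Ψ) (hlast : LastCouplingLipschitz E W T Ψ κ lam)
    (hρ : ∀ (k : ℕ) (P P' : ι → ℝ) (M : ℝ), (∀ y, |P y - P' y| ≤ wt k y * M) → ‖ρ k P - ρ k P'‖ ≤ M)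
    (hΨ : ∀ (k : ℕ) (s : ℝ) (P P' : ι → ℝ) (U : Bg) (X : C.Dom),
      Ψ k s P U X - Ψ k s P' U X =
        (Γ.geom.newTerm (Γ.geom.avgExpLinearAct μ pre fun k s U γ ω => evalFunctional (c k s U γ ω) (pt k s U γ ω))
            k s U X (ρ k P) -
          Γ.geom.newTerm (Γ.geom.avgExpLinearAct μ pre fun k s U γ ω => evalFunctional (c k s U γ ω) (pt k s U γ ω))
            k s U X (ρ k P')).re)
    -- the size-induction data (B0), (X), (N), (R′) — in place of the occupation hypothesis
    (hexpl : ∀ g ∈ W, ∀ (k : ℕ) (P : ι → ℝ) (U : Bg) (X : C.Dom), C.scale X = k + 1 →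
      |Ψ k (g k) P U X -
          (Γ.geom.newTerm (Γ.geom.avgExpLinearAct μ pre fun k s U γ ω => evalFunctional (c k s U γ ω) (pt k s U γ ω))
            k (g k) U X (ρ k P)).re| ≤ Real.exp (-(κ * C.d X)) * p₀ k)
    (hbase : ∀ g ∈ W, ∀ (U : Bg) (X : C.Dom), C.scale X = 0 → |E g U X| ≤ Real.exp (-(κ * C.d X)) * N 0)
    (hNsucc : ∀ j, p₀ j + B ≤ N (j + 1)) (hNnn : ∀ j, 0 ≤ N j)
    (hbox : ∀ (k : ℕ) (P : ι → ℝ), (∀ y, |P y| ≤ wt k y * sizeRadius τ N k) → ∀ x, ‖ρ k P x‖ ≤ β k x)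
    -- activity side: regularity data, scales, ONE integrability, (L′) scale bound
    (hpre : ∀ k s U γ, AEStronglyMeasurable (pre k s U γ) (μ k s U γ))
    (hc : ∀ k s U γ Y, AEStronglyMeasurable (fun ω => c k s U γ ω Y) (μ k s U γ))
    (hpt : ∀ k s U γ Y, Measurable fun ω => pt k s U γ ω Y) (hlip : ∀ k, 0 < lip k) (hlipb : ∀ k, lip k ≤ lipbar)
    (hint₀ : ∀ k s U γ, Integrable (fun ω => ‖pre k s U γ ω‖ * Real.exp (boxExponent c pt β k s U γ ω)) (μ k s U γ))
    (hL : ∀ k s U (γ : Finset α) ω, coeffSum c k s U γ ω ≤ lip k * (γ.card : ℝ))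
    -- THE THREE CURRENCY-AGNOSTIC BINDERS
    (ha : ∀ γ, 0 ≤ a γ) (hd : ∀ γ, 0 ≤ d γ)
    (hkpBox : ∀ g ∈ W, ∀ (k : ℕ) (U : Bg) (X : C.Dom), C.scale X = k + 1 → ∀ γ ∈ Γ.geom.vol X,
      ∑ γ' ∈ Γ.geom.vol X with Γ.geom.inc γ' γ,
        2 * ((1 + ((γ' : Finset α).card : ℝ)) *
          ∫ ω, ‖pre k (g k) U γ' ω‖ * Real.exp (boxExponent c pt β k (g k) U γ' ω) ∂(μ k (g k) U γ')) *
          Real.exp (a γ' + d γ') ≤ a γ)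
    (hdec : Γ.geom.DecayExtract δ d) (hpin : Γ.geom.PinBudget a δ (fun _ => B) κ)
    -- envelope data
    (hB : 0 ≤ B) (hℓ : 0 ≤ ℓ) (hτbar : 0 ≤ τbar) (hω : 0 ≤ ω) (hpos : 0 < ω + 4 * lipbar * B * τbar)
    (hlam : ∀ k, lam k ≤ ℓ) (hτ : ∀ k j, j ≤ k → 0 ≤ τ k j ∧ τ k j ≤ τbar * ω ^ (k - j)) :
    TermSize E W κ N ∧
      NE9 E W κ (prodModuli ℓ fun _ => ω + 4 * lipbar * B * τbar) ∧
        FadingMemory (ℓ / (ω + 4 * lipbar * B * τbar)) (ω + 4 * lipbar * B * τbar)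
          (prodModuli ℓ fun _ => ω + 4 * lipbar * B * τbar) := by
  have hKP := twoPointKP_of_boxMajorantClause Γ (W := W) (μ := μ) (pre := pre) (c := c) (pt := pt) (β := β) ha hd hlip
    hpre hc hpt hint₀ hL hkpBox
  have hind := termSize_of_recursion Γ.geom ρ hAdm (channelSizeNN_of_perStepNN hres hsum hstep) hfac hKP hdec hpin hexpl
    hbase (fun j => hNsucc j) hNnn (fun k P hP => mem_boxSet.2 (hbox k P hP))
  exact ⟨hind.1, ne9_and_fadingMemory_of_twoPointKP_perStep Γ.geom ρ h0 hAdm hres hadd hsum hstep hfac hlast hKP hdec hpin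
    hρ hΨ hind.2 hℓ hB hlipb hτbar hω hpos hlam hτ⟩

/-! ## §4 CONSISTENCY: the cube-count currency inhabits the three binders; the tree's END re-derived from §3 -/

omit [TopologicalSpace Sp] [MeasurableSpace Sp] [OpensMeasurableSpace Sp] in
/-- **THE CLAUSE IN CUBE-COUNT CURRENCY (kernel; consistency).**  The tree's (A″) decay of the box majorant `≤ ε k·y^{#γ′}` on the
step volumes with the scalars `2y·e^{a₁+d₁}·e^{Dθ} ≤ θ`, `2ε k·θ·(D+1) ≤ a₁` gives the §1 clause with the cube-count weights
`a = sizeWeight a₁`, `d = sizeWeight d₁` — EXACTLY the inner step of `T4HistoryLipschitzSegment.cubeChart_termSize_and_boxOcc`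
(`(1 + n)·yⁿ ≤ (2y)ⁿ`, ∘ `Supported.kpClause_of_decay`).  This is the inhabitant the existing faces use; its letters force `κ ≤ d₁ <
(rate of y)`, the division recorded in F-ne9leaf01-1. [cite: Balaban1988RG2Cluster, (2.26) p.17, (2.29)-(2.30) p.18, (2.37)-(2.41) pp.20-21; KoteckyPreiss1986, (1)-(3)] -/
theorem boxMajorantClause_of_cubeDecay (Γ : CubeChart C α adj D) {W : Set (ℕ → ℝ)}
    {μ : ℕ → ℝ → Bg → Finset α → Measure Ω} {pre : ℕ → ℝ → Bg → Finset α → Ω → ℂ}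
    {c : ℕ → ℝ → Bg → Finset α → Ω → F → ℂ} {pt : ℕ → ℝ → Bg → Finset α → Ω → F → Sp} {β : ℕ → Sp → ℝ}
    {ε : ℕ → ℝ} {y a₁ d₁ θ : ℝ} (hε : ∀ k, 0 ≤ ε k) (hy : 0 ≤ y)
    (hdecay₀ : ∀ g ∈ W, ∀ (k : ℕ) (U : Bg) (X : C.Dom), C.scale X = k + 1 → ∀ γ' ∈ Γ.vol X,
      ∫ ω, ‖pre k (g k) U γ' ω‖ * Real.exp (boxExponent c pt β k (g k) U γ' ω) ∂(μ k (g k) U γ') ≤ ε k * y ^ γ'.card)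
    (hθ : 2 * y * Real.exp (a₁ + d₁) * Real.exp (D * θ) ≤ θ) (hεθ : ∀ k, 2 * ε k * θ * ((D : ℝ) + 1) ≤ a₁) :
    ∀ g ∈ W, ∀ (k : ℕ) (U : Bg) (X : C.Dom), C.scale X = k + 1 → ∀ γ ∈ Γ.geom.vol X,
      ∑ γ' ∈ Γ.geom.vol X with Γ.geom.inc γ' γ,
        2 * ((1 + ((γ' : Finset α).card : ℝ)) *
          ∫ ω, ‖pre k (g k) U γ' ω‖ * Real.exp (boxExponent c pt β k (g k) U γ' ω) ∂(μ k (g k) U γ')) *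
          Real.exp (Γ.supported.sizeWeight a₁ γ' + Γ.supported.sizeWeight d₁ γ') ≤ Γ.supported.sizeWeight a₁ γ := by
  have hy2 : 0 ≤ 2 * y := by positivity
  have hM0 : ∀ (k : ℕ) (s : ℝ) (U : Bg) (γ' : Finset α), 0 ≤ 2 * ((1 + ((γ' : Finset α).card : ℝ)) *
      ∫ ω, ‖pre k s U γ' ω‖ * Real.exp (boxExponent c pt β k s U γ' ω) ∂(μ k s U γ')) := fun k s U γ' =>
    mul_nonneg (by norm_num) (mul_nonneg (by positivity)
      (integral_nonneg fun _ => mul_nonneg (norm_nonneg _) (Real.exp_pos _).le))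
  refine Γ.supported.kpClause_of_decay (W := W)
    (M := fun k s U γ' => 2 * ((1 + ((γ' : Finset α).card : ℝ)) *
      ∫ ω, ‖pre k s U γ' ω‖ * Real.exp (boxExponent c pt β k s U γ' ω) ∂(μ k s U γ')))
    (ε := fun k => 2 * ε k) (fun k => by have := hε k; positivity) hy2 hM0 (fun g hg k U X hX γ' hγ' => ?_) hθ
    (fun k => by simpa [mul_assoc, mul_comm, mul_left_comm] using hεθ k)
  show 2 * ((1 + ((γ' : Finset α).card : ℝ)) *
      ∫ ω, ‖pre k (g k) U γ' ω‖ * Real.exp (boxExponent c pt β k (g k) U γ' ω) ∂(μ k (g k) U γ')) ≤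
    2 * ε k * (2 * y) ^ (Γ.supported.supp γ').card
  rw [Γ.supported_supp]
  calc 2 * ((1 + ((γ' : Finset α).card : ℝ)) *
        ∫ ω, ‖pre k (g k) U γ' ω‖ * Real.exp (boxExponent c pt β k (g k) U γ' ω) ∂(μ k (g k) U γ'))
      ≤ 2 * ((1 + ((γ' : Finset α).card : ℝ)) * (ε k * y ^ γ'.card)) :=
        mul_le_mul_of_nonneg_left (mul_le_mul_of_nonneg_left (hdecay₀ g hg k U X hX γ' hγ') (by positivity)) (by norm_num)
    _ = 2 * ε k * ((1 + ((γ' : Finset α).card : ℝ)) * y ^ γ'.card) := by ring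
    _ ≤ 2 * ε k * (2 * y) ^ γ'.card :=
        mul_le_mul_of_nonneg_left (one_add_mul_pow_le hy _) (mul_nonneg (by norm_num) (hε k))

/-- **THE TREE'S SIZE-INDUCTION END RE-DERIVED FROM §3 (kernel; consistency).**  Hypothesis for hypothesis the statement of
`T4HistoryLipschitzSegment.cubeChart_ne9_and_fadingMemory_of_sizeInduction` (with its `TermSize` conjunct of
`cubeChart_termSize_and_boxOcc` added), obtained by instantiating §3 at the cube-count inhabitants: the clause of
`boxMajorantClause_of_cubeDecay`, `CubeChart.decayExtract` (`δ X = d₁·#cubes X`), `CubeChart.pinBudget` (`B = a₁`, `κ ≤ d₁`).  So the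
weight-generic trunk SUBSUMES the existing faces (hence E2/E5, which are this face on the torus); NE9-F8 part 1's d-currency
dischargers are to inhabit the same three binders (stage B, the E5′ face). [cite: Balaban1988RG2Cluster, (1.36) p.9, (2.15) p.15, (2.18)-(2.20) p.16, (2.23)-(2.26) p.17, (2.30) p.18, Lemma 3 (2.38) p.20, (2.41) p.21 and p.21 text; Balaban1987RG1, (0.23) p.256, (1.18) p.263; KoteckyPreiss1986, (1)-(3)] -/
theorem cubeChart_termSize_ne9_and_fadingMemory_of_sizeInduction' (Γ : CubeChart C α adj D) {ι : Type} {E : Functional C Bg}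
    {W : Set (ℕ → ℝ)} {Adm : Set (Bg → C.Dom → ℝ)} {T : ℕ → (ℕ → ℝ) → (Bg → C.Dom → ℝ) → ι → ℝ}
    {Ψ : ℕ → ℝ → (ι → ℝ) → Bg → C.Dom → ℝ}
    {μ : ℕ → ℝ → Bg → Finset α → Measure Ω} {pre : ℕ → ℝ → Bg → Finset α → Ω → ℂ}
    {c : ℕ → ℝ → Bg → Finset α → Ω → F → ℂ} {pt : ℕ → ℝ → Bg → Finset α → Ω → F → Sp} {β : ℕ → Sp → ℝ}
    {lip ε : ℕ → ℝ} {y a₁ d₁ θ κ lipbar ℓ τbar ω : ℝ} {wt : ℕ → ι → ℝ} {τ : ℕ → ℕ → ℝ} {lam p₀ N : ℕ → ℝ}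
    (ρ : ℕ → (ι → ℝ) → (Sp →ᵇ ℂ))
    (h0 : ScaleZeroFree E W) (hAdm : AdmissibleTerms E W Adm) (hres : AdmRestrict Adm)
    (hadd : ChannelAdditive Adm T) (hsum : ChannelStepSum Adm T) (hstep : ChannelSizeAtStepNN Adm T κ wt τ)
    (hfac : Factorises E W T Ψ) (hlast : LastCouplingLipschitz E W T Ψ κ lam)
    (hρ : ∀ (k : ℕ) (P P' : ι → ℝ) (M : ℝ), (∀ y, |P y - P' y| ≤ wt k y * M) → ‖ρ k P - ρ k P'‖ ≤ M)
    (hΨ : ∀ (k : ℕ) (s : ℝ) (P P' : ι → ℝ) (U : Bg) (X : C.Dom),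
      Ψ k s P U X - Ψ k s P' U X =
        (Γ.geom.newTerm (Γ.geom.avgExpLinearAct μ pre fun k s U γ ω => evalFunctional (c k s U γ ω) (pt k s U γ ω))
            k s U X (ρ k P) -
          Γ.geom.newTerm (Γ.geom.avgExpLinearAct μ pre fun k s U γ ω => evalFunctional (c k s U γ ω) (pt k s U γ ω))
            k s U X (ρ k P')).re)
    (hexpl : ∀ g ∈ W, ∀ (k : ℕ) (P : ι → ℝ) (U : Bg) (X : C.Dom), C.scale X = k + 1 →
      |Ψ k (g k) P U X -
          (Γ.geom.newTerm (Γ.geom.avgExpLinearAct μ pre fun k s U γ ω => evalFunctional (c k s U γ ω) (pt k s U γ ω))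
            k (g k) U X (ρ k P)).re| ≤ Real.exp (-(κ * C.d X)) * p₀ k)
    (hbase : ∀ g ∈ W, ∀ (U : Bg) (X : C.Dom), C.scale X = 0 → |E g U X| ≤ Real.exp (-(κ * C.d X)) * N 0)
    (hNsucc : ∀ j, p₀ j + a₁ ≤ N (j + 1)) (hNnn : ∀ j, 0 ≤ N j)
    (hbox : ∀ (k : ℕ) (P : ι → ℝ), (∀ y, |P y| ≤ wt k y * sizeRadius τ N k) → ∀ x, ‖ρ k P x‖ ≤ β k x)
    (hpre : ∀ k s U γ, AEStronglyMeasurable (pre k s U γ) (μ k s U γ))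
    (hc : ∀ k s U γ Y, AEStronglyMeasurable (fun ω => c k s U γ ω Y) (μ k s U γ))
    (hpt : ∀ k s U γ Y, Measurable fun ω => pt k s U γ ω Y) (hlip : ∀ k, 0 < lip k) (hlipb : ∀ k, lip k ≤ lipbar)
    (hint₀ : ∀ k s U γ, Integrable (fun ω => ‖pre k s U γ ω‖ * Real.exp (boxExponent c pt β k s U γ ω)) (μ k s U γ))
    (hL : ∀ k s U (γ : Finset α) ω, coeffSum c k s U γ ω ≤ lip k * (γ.card : ℝ))
    (hε : ∀ k, 0 ≤ ε k) (hy : 0 ≤ y)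
    (hdecay₀ : ∀ g ∈ W, ∀ (k : ℕ) (U : Bg) (X : C.Dom), C.scale X = k + 1 → ∀ γ' ∈ Γ.vol X,
      ∫ ω, ‖pre k (g k) U γ' ω‖ * Real.exp (boxExponent c pt β k (g k) U γ' ω) ∂(μ k (g k) U γ') ≤ ε k * y ^ γ'.card)
    (hθ : 2 * y * Real.exp (a₁ + d₁) * Real.exp (D * θ) ≤ θ) (hεθ : ∀ k, 2 * ε k * θ * ((D : ℝ) + 1) ≤ a₁)
    (ha₁ : 0 ≤ a₁) (hκ : 0 ≤ κ) (hκd : κ ≤ d₁) (hℓ : 0 ≤ ℓ) (hτbar : 0 ≤ τbar) (hω : 0 ≤ ω)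
    (hpos : 0 < ω + 4 * lipbar * a₁ * τbar) (hlam : ∀ k, lam k ≤ ℓ)
    (hτ : ∀ k j, j ≤ k → 0 ≤ τ k j ∧ τ k j ≤ τbar * ω ^ (k - j)) :
    TermSize E W κ N ∧
      NE9 E W κ (prodModuli ℓ fun _ => ω + 4 * lipbar * a₁ * τbar) ∧
        FadingMemory (ℓ / (ω + 4 * lipbar * a₁ * τbar)) (ω + 4 * lipbar * a₁ * τbar)
          (prodModuli ℓ fun _ => ω + 4 * lipbar * a₁ * τbar) := by
  have hd₁ : 0 ≤ d₁ := hκ.trans hκd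
  exact termSize_and_ne9_of_weightedClause Γ ρ h0 hAdm hres hadd hsum hstep hfac hlast hρ hΨ hexpl hbase hNsucc hNnn hbox
    hpre hc hpt hlip hlipb hint₀ hL (Γ.supported.sizeWeight_nonneg ha₁) (Γ.supported.sizeWeight_nonneg hd₁)
    (boxMajorantClause_of_cubeDecay Γ hε hy hdecay₀ hθ hεθ) (Γ.decayExtract hd₁) (Γ.pinBudget ha₁ hκ hκd) ha₁ hℓ hτbar
    hω hpos hlam hτ

/-- TYPE CHECK: the second conjunct of the primed theorem has LITERALLY the type of the tree's face
`cubeChart_ne9_and_fadingMemory_of_sizeInduction` (the equation between the two proofs elaborates iff the types agree; proofs of a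
proposition are definitionally equal, so the content of this `example` is the type agreement — nothing was lost in the un-wiring).
[folklore] -/
example (Γ : CubeChart C α adj D) {ι : Type} {E : Functional C Bg}
    {W : Set (ℕ → ℝ)} {Adm : Set (Bg → C.Dom → ℝ)} {T : ℕ → (ℕ → ℝ) → (Bg → C.Dom → ℝ) → ι → ℝ}
    {Ψ : ℕ → ℝ → (ι → ℝ) → Bg → C.Dom → ℝ}
    {μ : ℕ → ℝ → Bg → Finset α → Measure Ω} {pre : ℕ → ℝ → Bg → Finset α → Ω → ℂ}
    {c : ℕ → ℝ → Bg → Finset α → Ω → F → ℂ} {pt : ℕ → ℝ → Bg → Finset α → Ω → F → Sp} {β : ℕ → Sp → ℝ}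
    {lip ε : ℕ → ℝ} {y a₁ d₁ θ κ lipbar ℓ τbar ω : ℝ} {wt : ℕ → ι → ℝ} {τ : ℕ → ℕ → ℝ} {lam p₀ N : ℕ → ℝ}
    (ρ : ℕ → (ι → ℝ) → (Sp →ᵇ ℂ))
    (h0 : ScaleZeroFree E W) (hAdm : AdmissibleTerms E W Adm) (hres : AdmRestrict Adm)
    (hadd : ChannelAdditive Adm T) (hsum : ChannelStepSum Adm T) (hstep : ChannelSizeAtStepNN Adm T κ wt τ)
    (hfac : Factorises E W T Ψ) (hlast : LastCouplingLipschitz E W T Ψ κ lam)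
    (hρ : ∀ (k : ℕ) (P P' : ι → ℝ) (M : ℝ), (∀ y, |P y - P' y| ≤ wt k y * M) → ‖ρ k P - ρ k P'‖ ≤ M)
    (hΨ : ∀ (k : ℕ) (s : ℝ) (P P' : ι → ℝ) (U : Bg) (X : C.Dom),
      Ψ k s P U X - Ψ k s P' U X =
        (Γ.geom.newTerm (Γ.geom.avgExpLinearAct μ pre fun k s U γ ω => evalFunctional (c k s U γ ω) (pt k s U γ ω))
            k s U X (ρ k P) -
          Γ.geom.newTerm (Γ.geom.avgExpLinearAct μ pre fun k s U γ ω => evalFunctional (c k s U γ ω) (pt k s U γ ω))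
            k s U X (ρ k P')).re)
    (hexpl : ∀ g ∈ W, ∀ (k : ℕ) (P : ι → ℝ) (U : Bg) (X : C.Dom), C.scale X = k + 1 →
      |Ψ k (g k) P U X -
          (Γ.geom.newTerm (Γ.geom.avgExpLinearAct μ pre fun k s U γ ω => evalFunctional (c k s U γ ω) (pt k s U γ ω))
            k (g k) U X (ρ k P)).re| ≤ Real.exp (-(κ * C.d X)) * p₀ k)
    (hbase : ∀ g ∈ W, ∀ (U : Bg) (X : C.Dom), C.scale X = 0 → |E g U X| ≤ Real.exp (-(κ * C.d X)) * N 0)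
    (hNsucc : ∀ j, p₀ j + a₁ ≤ N (j + 1)) (hNnn : ∀ j, 0 ≤ N j)
    (hbox : ∀ (k : ℕ) (P : ι → ℝ), (∀ y, |P y| ≤ wt k y * sizeRadius τ N k) → ∀ x, ‖ρ k P x‖ ≤ β k x)
    (hpre : ∀ k s U γ, AEStronglyMeasurable (pre k s U γ) (μ k s U γ))
    (hc : ∀ k s U γ Y, AEStronglyMeasurable (fun ω => c k s U γ ω Y) (μ k s U γ))
    (hpt : ∀ k s U γ Y, Measurable fun ω => pt k s U γ ω Y) (hlip : ∀ k, 0 < lip k) (hlipb : ∀ k, lip k ≤ lipbar)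
    (hint₀ : ∀ k s U γ, Integrable (fun ω => ‖pre k s U γ ω‖ * Real.exp (boxExponent c pt β k s U γ ω)) (μ k s U γ))
    (hL : ∀ k s U (γ : Finset α) ω, coeffSum c k s U γ ω ≤ lip k * (γ.card : ℝ))
    (hε : ∀ k, 0 ≤ ε k) (hy : 0 ≤ y)
    (hdecay₀ : ∀ g ∈ W, ∀ (k : ℕ) (U : Bg) (X : C.Dom), C.scale X = k + 1 → ∀ γ' ∈ Γ.vol X,
      ∫ ω, ‖pre k (g k) U γ' ω‖ * Real.exp (boxExponent c pt β k (g k) U γ' ω) ∂(μ k (g k) U γ') ≤ ε k * y ^ γ'.card)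
    (hθ : 2 * y * Real.exp (a₁ + d₁) * Real.exp (D * θ) ≤ θ) (hεθ : ∀ k, 2 * ε k * θ * ((D : ℝ) + 1) ≤ a₁)
    (ha₁ : 0 ≤ a₁) (hκ : 0 ≤ κ) (hκd : κ ≤ d₁) (hℓ : 0 ≤ ℓ) (hτbar : 0 ≤ τbar) (hω : 0 ≤ ω)
    (hpos : 0 < ω + 4 * lipbar * a₁ * τbar) (hlam : ∀ k, lam k ≤ ℓ)
    (hτ : ∀ k j, j ≤ k → 0 ≤ τ k j ∧ τ k j ≤ τbar * ω ^ (k - j)) :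
    (cubeChart_termSize_ne9_and_fadingMemory_of_sizeInduction' Γ ρ h0 hAdm hres hadd hsum hstep hfac hlast hρ hΨ hexpl hbase
        hNsucc hNnn hbox hpre hc hpt hlip hlipb hint₀ hL hε hy hdecay₀ hθ hεθ ha₁ hκ hκd hℓ hτbar hω hpos hlam hτ).2 =
      cubeChart_ne9_and_fadingMemory_of_sizeInduction Γ ρ h0 hAdm hres hadd hsum hstep hfac hlast hρ hΨ hexpl hbase hNsucc
        hNnn hbox hpre hc hpt hlip hlipb hint₀ hL hε hy hdecay₀ hθ hεθ ha₁ hκ hκd hℓ hτbar hω hpos hlam hτ :=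
  rfl

end Summit.QuantumFields.BalabanUV.T4Continuum.NE9WeightedClauseEnd

end
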